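import Summits.CriticalPhenomena.CardyFormulaZ2.Theorems.CardyQContinuationFirstJetAtOneBounded

/-!
# Envelope of the crossing-odds cone (crux `UniformZeroFree`, stmt-CriticalPhenomena-5559)

Notation of the route `CardyQContinuation`: for a conformal rectangle `R`, mesh `δ` and complex
`s`, `w_s(ω) = s^(|ω| + 2 k_B(ω))` is the self-dual arc weight of a bond configuration
`ω ⊆ E(Ω_δ)`, `Z_δ(s) = Σ_ω w_s(ω)` the arc partition function, `N_δ(s) = Σ_{ω ∈ C_δ} w_s(ω)` its
crossing-restricted part and `N'_δ := Z_δ − N_δ` the non-crossing part.  The registered stub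
`stub_oddsCone` of the line `birth` of the crux asks for `ρ > 0`, `κ ∈ [0, 1)` with
`Re(N'_δ(s) · conj N_δ(s)) ≥ −κ ‖N'_δ(s)‖ ‖N_δ(s)‖` for all `s` within `ρ` of `[1, √2]`, for all
small `δ` — UNIFORMLY in `δ`.  This file proves the provable envelope of that statement, stated on
the SAME expressions (`let w := …; let Z := …; let N := …; …`) as the stub:

* `oddsCone_realAxis`, `oddsCone_realAxis_cone` — at real `s = t ≥ 0` (and `δ > 0`) both
  `N'_δ(t)` and `N_δ(t)` are non-negative reals, so `Re(N'_δ · conj N_δ) ≥ 0` and the cone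
  inequality holds at real points for every `κ ≥ 0`;
* `oddsCone_pointwise` — the cone condition POINTWISE in `δ`: for every `δ > 0` and `κ ≥ 0` there
  is `ρ > 0` (depending on `δ`) such that the inequality holds on the `ρ`-thickening of `[1, √2]`
  (continuity of the polynomials `N_δ, N'_δ ∈ ℕ[s]`, positivity on the compact segment, and
  `IsCompact.exists_thickening_subset_open`); the entire content of the stub is therefore the
  uniformity of `ρ` in `δ`;
* `oddsCone_conj_Z`, `oddsCone_conj_N` — `Z_δ(conj s) = conj Z_δ(s)`, `N_δ(conj s) = conj N_δ(s)`
  (the cone data is symmetric under `Im s ↦ −Im s`).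

The generic finite-sum lemmas (`oddsCone_cone_of_continuous`, `oddsCone_pointwise_finset`, …) are
stated for an arbitrary finite index set `F`, event `C` and exponents `m`; for `δ > 0` the
configurations `ω ⊆ E(Ω_δ)` form a finite set (`finite_powerset_edgeSet`), which converts the
route's `finsum`s into `Finset` sums (`finsum_mem_eq_finite_toFinset_sum`).
-/

namespace Summit.CriticalPhenomena.CardyFormulaZ2.Theorems.UniformZeroFree

open Filter Metric Set
open scoped Topology ComplexConjugate
open Literature.Probability.LatticeModels Literature.Probability.Percolation
open Literature.Probability.RandomPlanarGeometry
open Summit.CriticalPhenomena.CardyFormulaZ2.Theorems.CardyQContinuation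

noncomputable section

/-! ## Generic finite sums of (restricted) monomials -/

/-- `Σ_F s^{m a} − Σ_F 𝟙_C(a) s^{m a} = Σ_F 𝟙_{Cᶜ}(a) s^{m a}`. [folklore] -/
theorem oddsCone_sum_sub_sum_indicator {α : Type*} (F : Finset α) (C : Set α) (m : α → ℕ)
    (s : ℂ) :
    (∑ a ∈ F, s ^ m a) - (∑ a ∈ F, C.indicator (fun b => s ^ m b) a)
      = ∑ a ∈ F, Cᶜ.indicator (fun b => s ^ m b) a := by
  rw [← Finset.sum_sub_distrib]
  refine Finset.sum_congr rfl fun a _ => ?_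
  by_cases ha : a ∈ C
  · simp [Set.indicator_of_mem ha, Set.indicator_of_notMem (Set.notMem_compl_iff.2 ha)]
  · simp [Set.indicator_of_notMem ha, Set.indicator_of_mem (Set.mem_compl ha)]

/-- At a real point a sum of restricted monomials is the real sum, cast to `ℂ`. [folklore] -/
theorem oddsCone_sum_indicator_ofReal {α : Type*} (F : Finset α) (C : Set α) (m : α → ℕ)
    (t : ℝ) :
    (∑ a ∈ F, C.indicator (fun b => (t : ℂ) ^ m b) a)
      = ((∑ a ∈ F, C.indicator (fun b => t ^ m b) a : ℝ) : ℂ) := by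
  rw [Complex.ofReal_sum]
  refine Finset.sum_congr rfl fun a _ => ?_
  by_cases ha : a ∈ C
  · simp [Set.indicator_of_mem ha]
  · simp [Set.indicator_of_notMem ha]

/-- A real sum of restricted monomials is non-negative at `t ≥ 0`. [folklore] -/
theorem oddsCone_sum_indicator_nonneg {α : Type*} (F : Finset α) (C : Set α) (m : α → ℕ)
    {t : ℝ} (ht : 0 ≤ t) :
    0 ≤ ∑ a ∈ F, C.indicator (fun b => t ^ m b) a :=
  Finset.sum_nonneg fun a _ => Set.indicator_nonneg (fun b _ => pow_nonneg ht (m b)) a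

/-- Dichotomy for a sum of restricted monomials: either it vanishes identically in `s` (no index
of `F` lies in `C`) or it is strictly positive at every real `t > 0`. [folklore] -/
theorem oddsCone_sum_indicator_dichotomy {α : Type*} (F : Finset α) (C : Set α) (m : α → ℕ) :
    (∀ s : ℂ, (∑ a ∈ F, C.indicator (fun b => s ^ m b) a) = 0) ∨
      ∀ t : ℝ, 0 < t → 0 < ∑ a ∈ F, C.indicator (fun b => t ^ m b) a := by
  by_cases h : ∃ a ∈ F, a ∈ C
  · right
    intro t ht
    obtain ⟨a, haF, haC⟩ := h
    refine Finset.sum_pos' (fun b _ => Set.indicator_nonneg (fun c _ => pow_nonneg ht.le (m c)) b)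
      ⟨a, haF, ?_⟩
    rw [Set.indicator_of_mem haC]
    exact pow_pos ht (m a)
  · left
    push Not at h
    intro s
    exact Finset.sum_eq_zero fun a ha => Set.indicator_of_notMem (h a ha) _

/-- A sum of restricted monomials is continuous in `s`. [folklore] -/
theorem oddsCone_continuous_sum_indicator {α : Type*} (F : Finset α) (C : Set α) (m : α → ℕ) :
    Continuous fun s : ℂ => ∑ a ∈ F, C.indicator (fun b => s ^ m b) a := by
  refine continuous_finsetSum F fun a _ => ?_
  by_cases ha : a ∈ C
  · simp only [Set.indicator_of_mem ha]
    exact continuous_pow (m a)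
  · simp only [Set.indicator_of_notMem ha]
    exact continuous_const

/-- If `z, w ∈ ℂ` are real and non-negative then `Re(z · conj w) ≥ 0`. [folklore] -/
theorem oddsCone_re_mul_conj_nonneg {z w : ℂ} (hz : z.im = 0) (hw : w.im = 0) (hz' : 0 ≤ z.re)
    (hw' : 0 ≤ w.re) : 0 ≤ (z * conj w).re := by
  simp only [Complex.mul_re, Complex.conj_re, Complex.conj_im, hz, hw, neg_zero, mul_zero,
    sub_zero]
  exact mul_nonneg hz' hw'

/-- **Real axis, finite-sum form.** At real `t ≥ 0`, with `Z(t) = Σ_F t^{m a}` and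
`N(t) = Σ_F 𝟙_C(a) t^{m a}`: `Z(t) − N(t)` and `N(t)` are real and non-negative. [folklore] -/
theorem oddsCone_realAxis_finset {α : Type*} (F : Finset α) (C : Set α) (m : α → ℕ) {t : ℝ}
    (ht : 0 ≤ t) :
    ((((∑ a ∈ F, (t : ℂ) ^ m a) - ∑ a ∈ F, C.indicator (fun b => (t : ℂ) ^ m b) a).im = 0 ∧
      0 ≤ ((∑ a ∈ F, (t : ℂ) ^ m a) - ∑ a ∈ F, C.indicator (fun b => (t : ℂ) ^ m b) a).re)) ∧
    ((∑ a ∈ F, C.indicator (fun b => (t : ℂ) ^ m b) a).im = 0 ∧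
      0 ≤ (∑ a ∈ F, C.indicator (fun b => (t : ℂ) ^ m b) a).re) := by
  rw [oddsCone_sum_sub_sum_indicator, oddsCone_sum_indicator_ofReal,
    oddsCone_sum_indicator_ofReal]
  refine ⟨⟨Complex.ofReal_im _, ?_⟩, Complex.ofReal_im _, ?_⟩
  · rw [Complex.ofReal_re]
    exact oddsCone_sum_indicator_nonneg F Cᶜ m ht
  · rw [Complex.ofReal_re]
    exact oddsCone_sum_indicator_nonneg F C m ht

/-- **Real axis, finite-sum form: the cone inequality at real `t ≥ 0` for every `κ ≥ 0`.**
[folklore] -/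
theorem oddsCone_realAxis_cone_finset {α : Type*} (F : Finset α) (C : Set α) (m : α → ℕ)
    {t : ℝ} (ht : 0 ≤ t) {κ : ℝ} (hκ : 0 ≤ κ) :
    -(κ * (‖(∑ a ∈ F, (t : ℂ) ^ m a) - ∑ a ∈ F, C.indicator (fun b => (t : ℂ) ^ m b) a‖
        * ‖∑ a ∈ F, C.indicator (fun b => (t : ℂ) ^ m b) a‖))
      ≤ (((∑ a ∈ F, (t : ℂ) ^ m a) - ∑ a ∈ F, C.indicator (fun b => (t : ℂ) ^ m b) a)
          * conj (∑ a ∈ F, C.indicator (fun b => (t : ℂ) ^ m b) a)).re := by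
  obtain ⟨⟨h1, h2⟩, h3, h4⟩ := oddsCone_realAxis_finset F C m ht
  exact le_trans (neg_nonpos.2 (mul_nonneg hκ (mul_nonneg (norm_nonneg _) (norm_nonneg _))))
    (oddsCone_re_mul_conj_nonneg h1 h3 h2 h4)

/-! ## The cone condition from continuity and compactness -/

/-- **Cone condition near a compact set.** If `P, Q : ℂ → ℂ` are continuous and either `P ≡ 0`,
or `Q ≡ 0`, or `Re(P · conj Q) > 0` on the compact set `K`, then for every `κ ≥ 0` there is
`ρ > 0` with `Re(P(s) · conj Q(s)) ≥ −κ ‖P(s)‖ ‖Q(s)‖` on the open `ρ`-thickening of `K`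
(`IsCompact.exists_thickening_subset_open` applied to the open set `{Re(P · conj Q) > 0}`).
[folklore] -/
theorem oddsCone_cone_of_continuous {P Q : ℂ → ℂ} (hP : Continuous P) (hQ : Continuous Q)
    {K : Set ℂ} (hK : IsCompact K) {κ : ℝ} (hκ : 0 ≤ κ)
    (h : (∀ s, P s = 0) ∨ (∀ s, Q s = 0) ∨ ∀ k ∈ K, 0 < (P k * conj (Q k)).re) :
    ∃ ρ > (0 : ℝ), ∀ s ∈ Metric.thickening ρ K,
      -(κ * (‖P s‖ * ‖Q s‖)) ≤ (P s * conj (Q s)).re := by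
  rcases h with h | h | h
  · exact ⟨1, one_pos, fun s _ => by simp [h s]⟩
  · exact ⟨1, one_pos, fun s _ => by simp [h s]⟩
  · have hU : IsOpen {s : ℂ | 0 < (P s * conj (Q s)).re} :=
      isOpen_lt continuous_const
        (Complex.continuous_re.comp (hP.mul (Complex.continuous_conj.comp hQ)))
    obtain ⟨ρ, hρ, hsub⟩ := hK.exists_thickening_subset_open hU h
    refine ⟨ρ, hρ, fun s hs => ?_⟩
    have hpos : 0 < (P s * conj (Q s)).re := hsub hs
    have hnn : 0 ≤ κ * (‖P s‖ * ‖Q s‖) := by positivity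
    linarith

/-- **Pointwise cone for finite sums of restricted monomials.** For a finite index set `F`, an
event `C`, exponents `m`, `κ ≥ 0` and a compact set `K ⊆ (0, ∞)` of reals: with
`Z(s) = Σ_F s^{m a}` and `N(s) = Σ_F 𝟙_C(a) s^{m a}`, there is `ρ > 0` such that
`Re((Z − N)(s) · conj N(s)) ≥ −κ ‖(Z − N)(s)‖ ‖N(s)‖` for all complex `s` within `ρ` of `K`
(`Z − N` and `N` are non-negative real on `(0, ∞)`, each either `≡ 0` or `> 0` there). [folklore] -/
theorem oddsCone_pointwise_finset {α : Type*} (F : Finset α) (C : Set α) (m : α → ℕ) {κ : ℝ}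
    (hκ : 0 ≤ κ) {K : Set ℝ} (hK : IsCompact K) (hKpos : ∀ t ∈ K, 0 < t) :
    ∃ ρ > (0 : ℝ), ∀ s ∈ Metric.thickening ρ (((↑) : ℝ → ℂ) '' K),
      -(κ * (‖(∑ a ∈ F, s ^ m a) - ∑ a ∈ F, C.indicator (fun b => s ^ m b) a‖
          * ‖∑ a ∈ F, C.indicator (fun b => s ^ m b) a‖))
        ≤ (((∑ a ∈ F, s ^ m a) - ∑ a ∈ F, C.indicator (fun b => s ^ m b) a)
            * conj (∑ a ∈ F, C.indicator (fun b => s ^ m b) a)).re := by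
  simp only [oddsCone_sum_sub_sum_indicator]
  refine oddsCone_cone_of_continuous (oddsCone_continuous_sum_indicator F Cᶜ m)
    (oddsCone_continuous_sum_indicator F C m) (hK.image Complex.continuous_ofReal) hκ ?_
  rcases oddsCone_sum_indicator_dichotomy F Cᶜ m with h1 | h1
  · exact Or.inl h1
  rcases oddsCone_sum_indicator_dichotomy F C m with h2 | h2
  · exact Or.inr (Or.inl h2)
  refine Or.inr (Or.inr ?_)
  rintro k ⟨t, ht, rfl⟩
  rw [oddsCone_sum_indicator_ofReal, oddsCone_sum_indicator_ofReal, Complex.conj_ofReal,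
    ← Complex.ofReal_mul, Complex.ofReal_re]
  exact mul_pos (h1 t (hKpos t ht)) (h2 t (hKpos t ht))

/-! ## Complex conjugation -/

/-- Conjugation commutes with indicators. [folklore] -/
theorem oddsCone_conj_indicator {α : Type*} (C : Set α) (f : α → ℂ) (a : α) :
    conj (C.indicator f a) = C.indicator (fun b => conj (f b)) a := by
  by_cases ha : a ∈ C
  · simp [Set.indicator_of_mem ha]
  · simp [Set.indicator_of_notMem ha]

/-- Conjugation commutes with `finsum` over a set (no finiteness needed: `conj` is an injective
additive map). [folklore] -/
theorem oddsCone_conj_finsum_mem {α : Type*} (S : Set α) (f : α → ℂ) :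
    conj (∑ᶠ a ∈ S, f a) = ∑ᶠ a ∈ S, conj (f a) := by
  have h1 : ⇑(starRingEnd ℂ) = ⇑((starRingEnd ℂ).toAddMonoidHom) := rfl
  simp only [finsum_mem_def]
  rw [h1, AddMonoidHom.map_finsum_of_injective _ (RingHom.injective (starRingEnd ℂ))]
  refine finsum_congr fun a => ?_
  rw [map_indicator]
  rfl

end

/-! ## The envelope on the route's objects

The statements below use the SAME `let w := …; let Z := …; let N := …` bindings as the
registered stub `stub_oddsCone` (and the crux `UniformZeroFree`), so after `dsimp only` they
speak about literally the same terms. -/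

/-- **(E1) Real axis.** For a conformal rectangle `R`, mesh `δ > 0` and real `t ≥ 0`, the
non-crossing part `Z_δ(t) − N_δ(t)` and the crossing part `N_δ(t)` of the self-dual arc partition
function are non-negative reals. [folklore] -/
theorem oddsCone_realAxis :
    let w : Literature.Probability.RandomPlanarGeometry.ConformalRectangle → ℝ → ℂ →
        Set (Sym2 (Literature.Probability.LatticeModels.Site 2)) → ℂ :=
      fun R δ s ω ↦ s ^ (ω.ncard + 2 * Nat.card ((Literature.Probability.Percolation.openGraph ω ⊔
        Literature.Probability.LatticeModels.wired
          (Literature.Probability.LatticeModels.discreteArc R.carrier δ (R.arc 0) ∪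
            Literature.Probability.LatticeModels.discreteArc R.carrier δ (R.arc 2))).induce
        (Literature.Probability.LatticeModels.meshDomain R.carrier δ)).ConnectedComponent)
    let Z : Literature.Probability.RandomPlanarGeometry.ConformalRectangle → ℝ → ℂ → ℂ :=
      fun R δ s ↦ ∑ᶠ ω ∈ 𝒫 (Literature.Probability.LatticeModels.discreteDomainGraph
        R.carrier δ).edgeSet, w R δ s ω
    let N : Literature.Probability.RandomPlanarGeometry.ConformalRectangle → ℝ → ℂ → ℂ :=
      fun R δ s ↦ ∑ᶠ ω ∈ 𝒫 (Literature.Probability.LatticeModels.discreteDomainGraph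
        R.carrier δ).edgeSet, (Literature.Probability.Percolation.discreteCrossing R.carrier δ
          (R.arc 0) (R.arc 2)).indicator (w R δ s) ω
    ∀ R : Literature.Probability.RandomPlanarGeometry.ConformalRectangle, ∀ δ : ℝ, 0 < δ →
      ∀ t : ℝ, 0 ≤ t →
        ((Z R δ t - N R δ t).im = 0 ∧ 0 ≤ (Z R δ t - N R δ t).re) ∧
          ((N R δ t).im = 0 ∧ 0 ≤ (N R δ t).re) := by
  dsimp only
  intro R δ hδ t ht
  have hfin := finite_powerset_edgeSet R.isBounded hδ
  simp only [finsum_mem_eq_finite_toFinset_sum _ hfin]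
  exact oddsCone_realAxis_finset _ _ _ ht

/-- **(E1') Real axis: the cone inequality of `stub_oddsCone` holds at every real `t ≥ 0`, for
every `δ > 0` and every `κ ≥ 0`** (both factors are non-negative reals there). [folklore] -/
theorem oddsCone_realAxis_cone :
    let w : Literature.Probability.RandomPlanarGeometry.ConformalRectangle → ℝ → ℂ →
        Set (Sym2 (Literature.Probability.LatticeModels.Site 2)) → ℂ :=
      fun R δ s ω ↦ s ^ (ω.ncard + 2 * Nat.card ((Literature.Probability.Percolation.openGraph ω ⊔
        Literature.Probability.LatticeModels.wired
          (Literature.Probability.LatticeModels.discreteArc R.carrier δ (R.arc 0) ∪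
            Literature.Probability.LatticeModels.discreteArc R.carrier δ (R.arc 2))).induce
        (Literature.Probability.LatticeModels.meshDomain R.carrier δ)).ConnectedComponent)
    let Z : Literature.Probability.RandomPlanarGeometry.ConformalRectangle → ℝ → ℂ → ℂ :=
      fun R δ s ↦ ∑ᶠ ω ∈ 𝒫 (Literature.Probability.LatticeModels.discreteDomainGraph
        R.carrier δ).edgeSet, w R δ s ω
    let N : Literature.Probability.RandomPlanarGeometry.ConformalRectangle → ℝ → ℂ → ℂ :=
      fun R δ s ↦ ∑ᶠ ω ∈ 𝒫 (Literature.Probability.LatticeModels.discreteDomainGraph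
        R.carrier δ).edgeSet, (Literature.Probability.Percolation.discreteCrossing R.carrier δ
          (R.arc 0) (R.arc 2)).indicator (w R δ s) ω
    ∀ R : Literature.Probability.RandomPlanarGeometry.ConformalRectangle, ∀ δ : ℝ, 0 < δ →
      ∀ t : ℝ, 0 ≤ t → ∀ κ : ℝ, 0 ≤ κ →
        -(κ * (‖Z R δ t - N R δ t‖ * ‖N R δ t‖))
          ≤ ((Z R δ t - N R δ t) * (starRingEnd ℂ) (N R δ t)).re := by
  dsimp only
  intro R δ hδ t ht κ hκ
  have hfin := finite_powerset_edgeSet R.isBounded hδ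
  simp only [finsum_mem_eq_finite_toFinset_sum _ hfin]
  exact oddsCone_realAxis_cone_finset _ _ _ ht hκ

/-- **(E2) The crossing-odds cone, POINTWISE in `δ`.** For every conformal rectangle `R`, every
mesh `δ > 0` and every `κ ≥ 0` there is `ρ > 0` (depending on `δ`) such that for all complex `s`
within `ρ` of the segment `[1, √2]`,
`Re((Z_δ(s) − N_δ(s)) · conj N_δ(s)) ≥ −κ ‖Z_δ(s) − N_δ(s)‖ ‖N_δ(s)‖`.
This is the registered stub `stub_oddsCone` with the quantifiers `∃ ρ` and `∀ᶠ δ` swapped (and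
its `let w; let Z; let N` written out: the statement is the `dsimp only`-normal form of the
let-form, so it applies to the stub's goal after `intro w Z N R …` verbatim): the whole content
of the stub is the uniformity of `ρ` in `δ`.  Proof: `Z_δ − N_δ` and `N_δ` are
polynomials in `s` with natural coefficients, each either identically zero or strictly positive
on `(0, ∞) ⊇ [1, √2]`; in the non-degenerate case `Re((Z_δ − N_δ) conj N_δ) > 0` on the compact
segment, hence on an open thickening of it. [folklore] -/
theorem oddsCone_pointwise : ∀ R : Literature.Probability.RandomPlanarGeometry.ConformalRectangle, ∀ δ : ℝ, 0 < δ → ∀ κ : ℝ, 0 ≤ κ → ∃ ρ > (0:ℝ), ∀ s ∈ Metric.thickening ρ (((↑) : ℝ → ℂ) '' Set.Icc (1:ℝ) (Real.sqrt 2)), -(κ * (‖(∑ᶠ ω ∈ 𝒫 (Literature.Probability.LatticeModels.discreteDomainGraph R.carrier δ).edgeSet, s ^ (ω.ncard + 2 * Nat.card ((Literature.Probability.Percolation.openGraph ω ⊔ Literature.Probability.LatticeModels.wired (Literature.Probability.LatticeModels.discreteArc R.carrier δ (R.arc 0) ∪ Literature.Probability.LatticeModels.discreteArc R.carrier δ (R.arc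 2))).induce (Literature.Probability.LatticeModels.meshDomain R.carrier δ)).ConnectedComponent)) - (∑ᶠ ω ∈ 𝒫 (Literature.Probability.LatticeModels.discreteDomainGraph R.carrier δ).edgeSet, (Literature.Probability.Percolation.discreteCrossing R.carrier δ (R.arc 0) (R.arc 2)).indicator (fun ω ↦ s ^ (ω.ncard + 2 * Nat.card ((Literature.Probability.Percolation.openGraph ω ⊔ Literature.Probability.LatticeModels.wired (Literature.Probability.LatticeModels.discreteArc R.carrier δ (R.arc 0) ∪ Literature.Probability.LatticeModels.discreteArc R.carrier δ (R.arc 2))).induce (Literature.Probability.LatticeModels.meshDomain R.carrier δ)).ConnectedComponent)) ω)‖ * ‖∑ᶠ ω ∈ 𝒫 (Literature.Probability.LatticeModels.discreteDomainGraph R.carrier δ).edgeSet, (Literature.Probability.Percolation.discreteCrossing R.carrier δ (R.arc 0) (R.arc 2)).indicator (fun ω ↦ s ^ (ω.ncard + 2 * Nat.card ((Literature.Probability.Percolation.openGraph ω ⊔ Literature.Probability.LatticeModels.wired (Literature.Probability.LatticeModels.discreteArc R.carrier δ (R.arc 0) ∪ Literature.Probability.LatticeModels.discreteArc R.carrier δ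 (R.arc 2))).induce (Literature.Probability.LatticeModels.meshDomain R.carrier δ)).ConnectedComponent)) ω‖)) ≤ (((∑ᶠ ω ∈ 𝒫 (Literature.Probability.LatticeModels.discreteDomainGraph R.carrier δ).edgeSet, s ^ (ω.ncard + 2 * Nat.card ((Literature.Probability.Percolation.openGraph ω ⊔ Literature.Probability.LatticeModels.wired (Literature.Probability.LatticeModels.discreteArc R.carrier δ (R.arc 0) ∪ Literature.Probability.LatticeModels.discreteArc R.carrier δ (R.arc 2))).induce (Literature.Probability.LatticeModels.meshDomain R.carrier δ)).ConnectedComponent)) - (∑ᶠ ω ∈ 𝒫 (Literature.Probability.LatticeModels.discreteDomainGraph R.carrier δ).edgeSet, (Literature.Probability.Percolation.discreteCrossing R.carrier δ (R.arc 0) (R.arc 2)).indicator (fun ω ↦ s ^ (ω.ncard + 2 * Nat.card ((Literature.Probability.Percolation.openGraph ω ⊔ Literature.Probability.LatticeModels.wired (Literature.Probability.LatticeModels.discreteArc R.carrier δ (R.arc 0) ∪ Literature.Probability.LatticeModels.discreteArc R.carrier δ (R.arc 2))).induce (Literature.Probability.LatticeModels.meshDomain R.carrier δ)).ConnectedComponent))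 ω)) * (starRingEnd ℂ) (∑ᶠ ω ∈ 𝒫 (Literature.Probability.LatticeModels.discreteDomainGraph R.carrier δ).edgeSet, (Literature.Probability.Percolation.discreteCrossing R.carrier δ (R.arc 0) (R.arc 2)).indicator (fun ω ↦ s ^ (ω.ncard + 2 * Nat.card ((Literature.Probability.Percolation.openGraph ω ⊔ Literature.Probability.LatticeModels.wired (Literature.Probability.LatticeModels.discreteArc R.carrier δ (R.arc 0) ∪ Literature.Probability.LatticeModels.discreteArc R.carrier δ (R.arc 2))).induce (Literature.Probability.LatticeModels.meshDomain R.carrier δ)).ConnectedComponent)) ω)).re := by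
  intro R δ hδ κ hκ
  have hfin := finite_powerset_edgeSet R.isBounded hδ
  simp only [finsum_mem_eq_finite_toFinset_sum _ hfin]
  exact oddsCone_pointwise_finset hfin.toFinset _ _ hκ isCompact_Icc
    fun t ht => one_pos.trans_le ht.1

/-- **(E3) Conjugation symmetry of `Z_δ`:** `Z_δ(conj s) = conj Z_δ(s)` (all `δ`; the weights are
monomials with natural exponents). [folklore] -/
theorem oddsCone_conj_Z :
    let w : Literature.Probability.RandomPlanarGeometry.ConformalRectangle → ℝ → ℂ →
        Set (Sym2 (Literature.Probability.LatticeModels.Site 2)) → ℂ :=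
      fun R δ s ω ↦ s ^ (ω.ncard + 2 * Nat.card ((Literature.Probability.Percolation.openGraph ω ⊔
        Literature.Probability.LatticeModels.wired
          (Literature.Probability.LatticeModels.discreteArc R.carrier δ (R.arc 0) ∪
            Literature.Probability.LatticeModels.discreteArc R.carrier δ (R.arc 2))).induce
        (Literature.Probability.LatticeModels.meshDomain R.carrier δ)).ConnectedComponent)
    let Z : Literature.Probability.RandomPlanarGeometry.ConformalRectangle → ℝ → ℂ → ℂ :=
      fun R δ s ↦ ∑ᶠ ω ∈ 𝒫 (Literature.Probability.LatticeModels.discreteDomainGraph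
        R.carrier δ).edgeSet, w R δ s ω
    ∀ R : Literature.Probability.RandomPlanarGeometry.ConformalRectangle, ∀ δ : ℝ, ∀ s : ℂ,
      Z R δ ((starRingEnd ℂ) s) = (starRingEnd ℂ) (Z R δ s) := by
  dsimp only
  intro R δ s
  rw [oddsCone_conj_finsum_mem]
  simp only [map_pow]

/-- **(E3) Conjugation symmetry of `N_δ`:** `N_δ(conj s) = conj N_δ(s)` (all `δ`). [folklore] -/
theorem oddsCone_conj_N :
    let w : Literature.Probability.RandomPlanarGeometry.ConformalRectangle → ℝ → ℂ →
        Set (Sym2 (Literature.Probability.LatticeModels.Site 2)) → ℂ :=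
      fun R δ s ω ↦ s ^ (ω.ncard + 2 * Nat.card ((Literature.Probability.Percolation.openGraph ω ⊔
        Literature.Probability.LatticeModels.wired
          (Literature.Probability.LatticeModels.discreteArc R.carrier δ (R.arc 0) ∪
            Literature.Probability.LatticeModels.discreteArc R.carrier δ (R.arc 2))).induce
        (Literature.Probability.LatticeModels.meshDomain R.carrier δ)).ConnectedComponent)
    let N : Literature.Probability.RandomPlanarGeometry.ConformalRectangle → ℝ → ℂ → ℂ :=
      fun R δ s ↦ ∑ᶠ ω ∈ 𝒫 (Literature.Probability.LatticeModels.discreteDomainGraph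
        R.carrier δ).edgeSet, (Literature.Probability.Percolation.discreteCrossing R.carrier δ
          (R.arc 0) (R.arc 2)).indicator (w R δ s) ω
    ∀ R : Literature.Probability.RandomPlanarGeometry.ConformalRectangle, ∀ δ : ℝ, ∀ s : ℂ,
      N R δ ((starRingEnd ℂ) s) = (starRingEnd ℂ) (N R δ s) := by
  dsimp only
  intro R δ s
  rw [oddsCone_conj_finsum_mem]
  simp only [oddsCone_conj_indicator, map_pow]

end Summit.CriticalPhenomena.CardyFormulaZ2.Theorems.UniformZeroFree
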